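import Mathlib
import Summits.ValiantsHypothesis.ValiantsHypothesis.Theses.ValuativeGCT
import Summits.ValiantsHypothesis.ValiantsHypothesis.Theorems.ValuativeGCTValuativeFlipInnerMonotone

/-!
# `ValuativeGCT.ValuativeFlip` (stmt-ValiantsHypothesis-12624): steep and shallow edges of the split
# items — size-transfer axis, part Ib

Sequel to `ValuativeGCTValuativeFlipInnerMonotone` (wall-breaker k12/16, 2026-08-16).  The flip body is
upward closed in the inner size `n` (`flipBody_mono_inner`) and the no-flip body downward closed
(`noFlipBody_anti_inner`); here are the resulting one-parameter normal forms of the three items that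
quantify over window positions, and of the crux itself:

* `valuativeFlip_iff_steep` — `ValuativeFlip` is equivalent to the same statement with the body required
  only at the least admissible inner size of each window column (`n = n₀` or `2^((log₂(n-1)+c)^c) < m`);
* `headFlip_iff_steep` — the linear head `HeadFlip` (stmt-15535, slope `a/b`) is equivalent to the same
  statement with the body required only at the least admissible `n` of each `m` (`n = n₀` or
  `a (n-1) < b m`, i.e. `n = max n₀ ⌈b m / a⌉`);
* `tailFlip_iff_steep` — the tail `TailFlip` (stmt-15687) is equivalent to the same statement with the
  body required only where `n = n₀` or `2^((log₂(n-1)+c)^c) < m`;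
* `noValuativeFlip_iff_shallow` — the kill statement `NoValuativeFlip` (stmt-12629) is equivalent to
  the same statement with `1 ≤ c₀` and the body required only on the shallow edge `n^c₀ ≤ m < (n+1)^c₀`.

Pure logic over part I. [this crux; elementary]
-/

set_option linter.dupNamespace false

namespace Summit.ValiantsHypothesis.ValiantsHypothesis.Theorems.ValuativeFlip

open scoped BigOperators Matrix
open MvPolynomial
open Literature.NumberTheory.DiophantineGeometry
open Literature.Computability.AlgebraicComplexity
open Summit.ValiantsHypothesis.ValiantsHypothesis.Theses.ValuativeGCT

noncomputable section

/-- **The crux is its steep edge.**  `ValuativeFlip` is equivalent to the same statement in which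
the body is required only at the LEAST admissible inner size of each window column: at `(n, m)` with
`n ≤ m ≤ 2^((log₂ n + c)^c)` one may additionally assume that either `n = n₀` or `n - 1` is no longer
admissible, `2^((log₂ (n-1) + c)^c) < m` (body verbatim the route decl's).  `→` is trivial; `←`
takes, for a given `(n, m)`, the least admissible `n₁ ∈ [n₀, n]` and moves the witness up from
`(n₁, m)` to `(n, m)` by `flipBody_mono_inner`.  So the content of the crux is a ONE-parameter family
of window positions (the most padded one for each `m`). [this file] -/
theorem valuativeFlip_iff_steep :
    Summit.ValiantsHypothesis.ValiantsHypothesis.Theses.ValuativeGCT.ValuativeFlip ↔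
      ∀ c : ℕ, ∃ n₀ : ℕ, ∀ n ≥ n₀, ∀ (m : ℕ) [NeZero m], n ≤ m → m ≤ 2 ^ ((Nat.log 2 n + c) ^ c) →
        (n₀ < n → 2 ^ ((Nat.log 2 (n - 1) + c) ^ c) < m) →
        ∃ (U : Submodule ℂ (MatIdx m → ℂ)) (r δ : ℕ) (lam : Nat.Partition (m * δ)),
          (∀ u ∈ U, (Matrix.of fun a b : Fin m => u (toLex (a, b))).rank ≤ r) ∧ lam.parts.card ≤ m * m ∧
            Module.finrank ℂ ↥(MvPolynomial.homogeneousSubmodule (MatIdx m × MatIdx m) ℂ (m * δ) ⊓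
                ((MvPolynomial.vanishingIdeal ℂ
                    {p : MatIdx m × MatIdx m → ℂ | ∀ j : MatIdx m, (fun i => p (j, i)) ∈ U}) ^ (δ * (m - r))).restrictScalars ℂ ⊓
                (⨅ (M : Matrix (MatIdx m) (MatIdx m) ℂ)
                  (_ : linSubst (MatIdx m) ℂ M (detFormLex ℂ m) = detFormLex ℂ m),
                  LinearMap.ker ((MvPolynomial.aeval fun p : MatIdx m × MatIdx m =>
                      ∑ l : MatIdx m, M l p.2 •
                        (MvPolynomial.X (p.1, l) : MvPolynomial (MatIdx m × MatIdx m) ℂ)).toLinearMap -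
                    (LinearMap.id : MvPolynomial (MatIdx m × MatIdx m) ℂ →ₗ[ℂ] MvPolynomial (MatIdx m × MatIdx m) ℂ))) ⊓
                (⨅ (g : Matrix.GeneralLinearGroup (MatIdx m) ℂ) (_ : IsUpperTriangular g),
                  LinearMap.ker ((MvPolynomial.aeval fun p : MatIdx m × MatIdx m =>
                      ∑ l : MatIdx m, ((g⁻¹ : Matrix.GeneralLinearGroup (MatIdx m) ℂ) :
                        Matrix (MatIdx m) (MatIdx m) ℂ) p.1 l •
                          (MvPolynomial.X (l, p.2) : MvPolynomial (MatIdx m × MatIdx m) ℂ)).toLinearMap -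
                    weightChar ((Weight.dualOfPartition (m * m) lam).toMatIdx : Weight (MatIdx m)) g •
                      (LinearMap.id : MvPolynomial (MatIdx m × MatIdx m) ℂ →ₗ[ℂ] MvPolynomial (MatIdx m × MatIdx m) ℂ)))) <
              orbitMultiplicity ℂ (paddedPerFormLex ℂ n m) m
                ((Weight.dualOfPartition (m * m) lam).toMatIdx : Weight (MatIdx m)) := by
  constructor
  · intro h c
    obtain ⟨n₀, hn₀⟩ := h c
    exact ⟨n₀, fun n hn m _ hnm hm _ => hn₀ n hn m hnm hm⟩
  · intro h c
    obtain ⟨n₀, hn₀⟩ := h c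
    refine ⟨n₀, fun n hn m _ hnm hm => ?_⟩
    -- the steep-edge scheme with `P n m := NeZero m → body`, `Adm n m := m ≤ W_c(n)`
    have key := forall_adm_of_forall_steep (n₀ := n₀)
      (Adm := fun n m => m ≤ 2 ^ ((Nat.log 2 n + c) ^ c))
      (P := fun n m => ∀ _ : NeZero m, ∃ (U : Submodule ℂ (MatIdx m → ℂ)) (r δ : ℕ) (lam : Nat.Partition (m * δ)),
          (∀ u ∈ U, (Matrix.of fun a b : Fin m => u (toLex (a, b))).rank ≤ r) ∧ lam.parts.card ≤ m * m ∧
            Module.finrank ℂ ↥(MvPolynomial.homogeneousSubmodule (MatIdx m × MatIdx m) ℂ (m * δ) ⊓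
                ((MvPolynomial.vanishingIdeal ℂ
                    {p : MatIdx m × MatIdx m → ℂ | ∀ j : MatIdx m, (fun i => p (j, i)) ∈ U}) ^ (δ * (m - r))).restrictScalars ℂ ⊓
                (⨅ (M : Matrix (MatIdx m) (MatIdx m) ℂ)
                  (_ : linSubst (MatIdx m) ℂ M (detFormLex ℂ m) = detFormLex ℂ m),
                  LinearMap.ker ((MvPolynomial.aeval fun p : MatIdx m × MatIdx m =>
                      ∑ l : MatIdx m, M l p.2 •
                        (MvPolynomial.X (p.1, l) : MvPolynomial (MatIdx m × MatIdx m) ℂ)).toLinearMap -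
                    (LinearMap.id : MvPolynomial (MatIdx m × MatIdx m) ℂ →ₗ[ℂ] MvPolynomial (MatIdx m × MatIdx m) ℂ))) ⊓
                (⨅ (g : Matrix.GeneralLinearGroup (MatIdx m) ℂ) (_ : IsUpperTriangular g),
                  LinearMap.ker ((MvPolynomial.aeval fun p : MatIdx m × MatIdx m =>
                      ∑ l : MatIdx m, ((g⁻¹ : Matrix.GeneralLinearGroup (MatIdx m) ℂ) :
                        Matrix (MatIdx m) (MatIdx m) ℂ) p.1 l •
                          (MvPolynomial.X (l, p.2) : MvPolynomial (MatIdx m × MatIdx m) ℂ)).toLinearMap -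
                    weightChar ((Weight.dualOfPartition (m * m) lam).toMatIdx : Weight (MatIdx m)) g •
                      (LinearMap.id : MvPolynomial (MatIdx m × MatIdx m) ℂ →ₗ[ℂ] MvPolynomial (MatIdx m × MatIdx m) ℂ)))) <
              orbitMultiplicity ℂ (paddedPerFormLex ℂ n m) m
                ((Weight.dualOfPartition (m * m) lam).toMatIdx : Weight (MatIdx m)))
      (fun n n' m hnn' hn'm hP inst => @flipBody_mono_inner n n' m inst hnn' hn'm (hP inst))
      (fun n hn m hnm hadm hsteep inst => @hn₀ n hn m inst hnm hadm (fun hlt =>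
        lt_of_not_ge fun hle => hsteep (n - 1) (by omega) (by omega) hle))
    exact key n hn m hnm hm inferInstance

/-- **The linear head is its steep edge.**  `HeadFlip` (∃ slope `a/b > 1`, eventually in `n`, a flip
at every `n ≤ m ≤ (a/b) n`; body verbatim) is equivalent to the same statement with the body required
only at the least admissible inner size: one may assume `n = n₀` or `a (n - 1) < b m`.  (`←`: the
steep-edge scheme `forall_adm_of_forall_steep` with `Adm n m := b m ≤ a n`, moving witnesses up in `n`
by `flipBody_mono_inner`.) [this crux; elementary] -/
theorem headFlip_iff_steep :
    Summit.ValiantsHypothesis.ValiantsHypothesis.Theses.ValuativeGCT.HeadFlip ↔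
      ∃ a b : ℕ, b < a ∧ ∃ n₀ : ℕ, ∀ n ≥ n₀, ∀ (m : ℕ) [NeZero m], n ≤ m → b * m ≤ a * n →
        (n₀ < n → a * (n - 1) < b * m) →
        ∃ (U : Submodule ℂ (MatIdx m → ℂ)) (r δ : ℕ) (lam : Nat.Partition (m * δ)),
          (∀ u ∈ U, (Matrix.of fun a b : Fin m => u (toLex (a, b))).rank ≤ r) ∧ lam.parts.card ≤ m * m ∧
            (let χ : Weight (MatIdx m) := (Weight.dualOfPartition (m * m) lam).toMatIdx
            let T : Submodule ℂ (MvPolynomial (MatIdx m × MatIdx m) ℂ) :=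
              MvPolynomial.homogeneousSubmodule (MatIdx m × MatIdx m) ℂ (m * δ) ⊓
                ((MvPolynomial.vanishingIdeal ℂ
                    {p : MatIdx m × MatIdx m → ℂ | ∀ j : MatIdx m, (fun i => p (j, i)) ∈ U}) ^ (δ * (m - r))).restrictScalars ℂ ⊓
                (⨅ (M : Matrix (MatIdx m) (MatIdx m) ℂ)
                  (_ : linSubst (MatIdx m) ℂ M (detFormLex ℂ m) = detFormLex ℂ m),
                  LinearMap.ker ((MvPolynomial.aeval (R := ℂ) fun p : MatIdx m × MatIdx m =>
                      ∑ l : MatIdx m, M l p.2 • MvPolynomial.X (p.1, l)).toLinearMap -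
                    LinearMap.id (R := ℂ) (M := MvPolynomial (MatIdx m × MatIdx m) ℂ))) ⊓
                (⨅ (g : Matrix.GeneralLinearGroup (MatIdx m) ℂ) (_ : IsUpperTriangular g),
                  LinearMap.ker ((MvPolynomial.aeval (R := ℂ) fun p : MatIdx m × MatIdx m =>
                      ∑ l : MatIdx m, ((g⁻¹ : Matrix.GeneralLinearGroup (MatIdx m) ℂ) :
                        Matrix (MatIdx m) (MatIdx m) ℂ) p.1 l • MvPolynomial.X (l, p.2)).toLinearMap -
                    weightChar χ g • LinearMap.id (R := ℂ) (M := MvPolynomial (MatIdx m × MatIdx m) ℂ)))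
            Module.finrank ℂ ↥T < orbitMultiplicity ℂ (paddedPerFormLex ℂ n m) m χ) := by
  constructor
  · rintro ⟨a, b, hab, n₀, h⟩
    exact ⟨a, b, hab, n₀, fun n hn m _ hnm hadm _ => h n hn m hnm hadm⟩
  · rintro ⟨a, b, hab, n₀, h⟩
    refine ⟨a, b, hab, n₀, fun n hn m _ hnm hadm => ?_⟩
    have key := forall_adm_of_forall_steep (n₀ := n₀) (Adm := fun n m => b * m ≤ a * n)
      (P := fun n m => ∀ _ : NeZero m, ∃ (U : Submodule ℂ (MatIdx m → ℂ)) (r δ : ℕ) (lam : Nat.Partition (m * δ)),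
          (∀ u ∈ U, (Matrix.of fun a b : Fin m => u (toLex (a, b))).rank ≤ r) ∧ lam.parts.card ≤ m * m ∧
            (let χ : Weight (MatIdx m) := (Weight.dualOfPartition (m * m) lam).toMatIdx
            let T : Submodule ℂ (MvPolynomial (MatIdx m × MatIdx m) ℂ) :=
              MvPolynomial.homogeneousSubmodule (MatIdx m × MatIdx m) ℂ (m * δ) ⊓
                ((MvPolynomial.vanishingIdeal ℂ
                    {p : MatIdx m × MatIdx m → ℂ | ∀ j : MatIdx m, (fun i => p (j, i)) ∈ U}) ^ (δ * (m - r))).restrictScalars ℂ ⊓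
                (⨅ (M : Matrix (MatIdx m) (MatIdx m) ℂ)
                  (_ : linSubst (MatIdx m) ℂ M (detFormLex ℂ m) = detFormLex ℂ m),
                  LinearMap.ker ((MvPolynomial.aeval (R := ℂ) fun p : MatIdx m × MatIdx m =>
                      ∑ l : MatIdx m, M l p.2 • MvPolynomial.X (p.1, l)).toLinearMap -
                    LinearMap.id (R := ℂ) (M := MvPolynomial (MatIdx m × MatIdx m) ℂ))) ⊓
                (⨅ (g : Matrix.GeneralLinearGroup (MatIdx m) ℂ) (_ : IsUpperTriangular g),
                  LinearMap.ker ((MvPolynomial.aeval (R := ℂ) fun p : MatIdx m × MatIdx m =>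
                      ∑ l : MatIdx m, ((g⁻¹ : Matrix.GeneralLinearGroup (MatIdx m) ℂ) :
                        Matrix (MatIdx m) (MatIdx m) ℂ) p.1 l • MvPolynomial.X (l, p.2)).toLinearMap -
                    weightChar χ g • LinearMap.id (R := ℂ) (M := MvPolynomial (MatIdx m × MatIdx m) ℂ)))
            Module.finrank ℂ ↥T < orbitMultiplicity ℂ (paddedPerFormLex ℂ n m) m χ))
      (fun n n' m hnn' hn'm hP inst => @flipBody_mono_inner n n' m inst hnn' hn'm (hP inst))
      (fun n hn m hnm hadm hsteep inst => @h n hn m inst hnm hadm (fun hlt =>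
        lt_of_not_ge fun hle => hsteep (n - 1) (by omega) (by omega) hle))
    exact key n hn m hnm hadm inferInstance

/-- **The tail is its steep edge.**  `TailFlip` (∀ slopes `a/b > 1`, ∀ `c`, eventually in `n`, a flip
at every `(a/b) n < m ≤ 2^((log₂ n + c)^c)`; body verbatim) is equivalent to the same statement with
the body required only at the least admissible inner size: one may assume `n = n₀` or
`2^((log₂ (n-1) + c)^c) < m` (a smaller `n` only relaxes `a n < b m`).  [this crux; elementary] -/
theorem tailFlip_iff_steep :
    Summit.ValiantsHypothesis.ValiantsHypothesis.Theses.ValuativeGCT.TailFlip ↔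
      ∀ a b : ℕ, b < a → ∀ c : ℕ, ∃ n₀ : ℕ, ∀ n ≥ n₀, ∀ (m : ℕ) [NeZero m], a * n < b * m →
        m ≤ 2 ^ ((Nat.log 2 n + c) ^ c) → (n₀ < n → 2 ^ ((Nat.log 2 (n - 1) + c) ^ c) < m) →
        ∃ (U : Submodule ℂ (MatIdx m → ℂ)) (r δ : ℕ) (lam : Nat.Partition (m * δ)),
          (∀ u ∈ U, (Matrix.of fun a b : Fin m => u (toLex (a, b))).rank ≤ r) ∧ lam.parts.card ≤ m * m ∧
            (let χ : Weight (MatIdx m) := (Weight.dualOfPartition (m * m) lam).toMatIdx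
            let T : Submodule ℂ (MvPolynomial (MatIdx m × MatIdx m) ℂ) :=
              MvPolynomial.homogeneousSubmodule (MatIdx m × MatIdx m) ℂ (m * δ) ⊓
                ((MvPolynomial.vanishingIdeal ℂ
                    {p : MatIdx m × MatIdx m → ℂ | ∀ j : MatIdx m, (fun i => p (j, i)) ∈ U}) ^ (δ * (m - r))).restrictScalars ℂ ⊓
                (⨅ (M : Matrix (MatIdx m) (MatIdx m) ℂ)
                  (_ : linSubst (MatIdx m) ℂ M (detFormLex ℂ m) = detFormLex ℂ m),
                  LinearMap.ker ((MvPolynomial.aeval (R := ℂ) fun p : MatIdx m × MatIdx m =>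
                      ∑ l : MatIdx m, M l p.2 • MvPolynomial.X (p.1, l)).toLinearMap -
                    LinearMap.id (R := ℂ) (M := MvPolynomial (MatIdx m × MatIdx m) ℂ))) ⊓
                (⨅ (g : Matrix.GeneralLinearGroup (MatIdx m) ℂ) (_ : IsUpperTriangular g),
                  LinearMap.ker ((MvPolynomial.aeval (R := ℂ) fun p : MatIdx m × MatIdx m =>
                      ∑ l : MatIdx m, ((g⁻¹ : Matrix.GeneralLinearGroup (MatIdx m) ℂ) :
                        Matrix (MatIdx m) (MatIdx m) ℂ) p.1 l • MvPolynomial.X (l, p.2)).toLinearMap -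
                    weightChar χ g • LinearMap.id (R := ℂ) (M := MvPolynomial (MatIdx m × MatIdx m) ℂ)))
            Module.finrank ℂ ↥T < orbitMultiplicity ℂ (paddedPerFormLex ℂ n m) m χ) := by
  constructor
  · intro h a b hab c
    obtain ⟨n₀, hn₀⟩ := h a b hab c
    exact ⟨n₀, fun n hn m _ hanm hm _ => hn₀ n hn m hanm hm⟩
  · intro h a b hab c
    obtain ⟨n₀, hn₀⟩ := h a b hab c
    refine ⟨n₀, fun n hn m _ hanm hm => ?_⟩
    have hnm : n ≤ m := by
      by_contra hlt
      have hmn : m ≤ n := by omega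
      have : b * m ≤ a * n := (Nat.mul_le_mul_right m hab.le).trans (Nat.mul_le_mul_left a hmn)
      omega
    have key := forall_adm_of_forall_steep (n₀ := n₀)
      (Adm := fun n m => a * n < b * m ∧ m ≤ 2 ^ ((Nat.log 2 n + c) ^ c))
      (P := fun n m => ∀ _ : NeZero m, ∃ (U : Submodule ℂ (MatIdx m → ℂ)) (r δ : ℕ) (lam : Nat.Partition (m * δ)),
          (∀ u ∈ U, (Matrix.of fun a b : Fin m => u (toLex (a, b))).rank ≤ r) ∧ lam.parts.card ≤ m * m ∧
            (let χ : Weight (MatIdx m) := (Weight.dualOfPartition (m * m) lam).toMatIdx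
            let T : Submodule ℂ (MvPolynomial (MatIdx m × MatIdx m) ℂ) :=
              MvPolynomial.homogeneousSubmodule (MatIdx m × MatIdx m) ℂ (m * δ) ⊓
                ((MvPolynomial.vanishingIdeal ℂ
                    {p : MatIdx m × MatIdx m → ℂ | ∀ j : MatIdx m, (fun i => p (j, i)) ∈ U}) ^ (δ * (m - r))).restrictScalars ℂ ⊓
                (⨅ (M : Matrix (MatIdx m) (MatIdx m) ℂ)
                  (_ : linSubst (MatIdx m) ℂ M (detFormLex ℂ m) = detFormLex ℂ m),
                  LinearMap.ker ((MvPolynomial.aeval (R := ℂ) fun p : MatIdx m × MatIdx m =>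
                      ∑ l : MatIdx m, M l p.2 • MvPolynomial.X (p.1, l)).toLinearMap -
                    LinearMap.id (R := ℂ) (M := MvPolynomial (MatIdx m × MatIdx m) ℂ))) ⊓
                (⨅ (g : Matrix.GeneralLinearGroup (MatIdx m) ℂ) (_ : IsUpperTriangular g),
                  LinearMap.ker ((MvPolynomial.aeval (R := ℂ) fun p : MatIdx m × MatIdx m =>
                      ∑ l : MatIdx m, ((g⁻¹ : Matrix.GeneralLinearGroup (MatIdx m) ℂ) :
                        Matrix (MatIdx m) (MatIdx m) ℂ) p.1 l • MvPolynomial.X (l, p.2)).toLinearMap -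
                    weightChar χ g • LinearMap.id (R := ℂ) (M := MvPolynomial (MatIdx m × MatIdx m) ℂ)))
            Module.finrank ℂ ↥T < orbitMultiplicity ℂ (paddedPerFormLex ℂ n m) m χ))
      (fun n n' m hnn' hn'm hP inst => @flipBody_mono_inner n n' m inst hnn' hn'm (hP inst))
      (fun n hn m _ hadm hsteep inst => @hn₀ n hn m inst hadm.1 hadm.2 (fun hlt =>
        lt_of_not_ge fun hle => hsteep (n - 1) (by omega) (by omega)
          ⟨lt_of_le_of_lt (Nat.mul_le_mul_left a (Nat.sub_le n 1)) hadm.1, hle⟩))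
    exact key n hn m hnm ⟨hanm, hm⟩ inferInstance

/-- **`NoValuativeFlip` is its shallow edge.**  The kill statement `NoValuativeFlip` (stmt-12629:
from some polynomial padding `m ≥ n^c₀` on, NO admissible truncation flips; body verbatim the route
decl's `let χ … let T …`) is equivalent to the same statement with `1 ≤ c₀` and the body required only
at the LARGEST admissible inner size of each `m`, i.e. on the shallow edge `n^c₀ ≤ m < (n+1)^c₀`:
the no-flip body propagates down in `n` (`noFlipBody_anti_inner`).  (`→`: bump `c₀ ↦ c₀ + 1`,
`n₀ ↦ max n₀ 1`; `←`: `n₁ := Nat.findGreatest (·^c₀ ≤ m) m ≥ n`.) [this file] -/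
theorem noValuativeFlip_iff_shallow :
    Summit.ValiantsHypothesis.ValiantsHypothesis.Theses.ValuativeGCT.NoValuativeFlip ↔
      ∃ c₀ n₀ : ℕ, 1 ≤ c₀ ∧ ∀ n ≥ n₀, ∀ (m : ℕ) [NeZero m], n ^ c₀ ≤ m → m < (n + 1) ^ c₀ →
        ∀ (U : Submodule ℂ (MatIdx m → ℂ)) (r : ℕ),
          (∀ u ∈ U, (Matrix.of fun a b : Fin m => u (toLex (a, b))).rank ≤ r) →
            ∀ (δ : ℕ) (lam : Nat.Partition (m * δ)), lam.parts.card ≤ m * m →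
              (let χ : Weight (MatIdx m) := (Weight.dualOfPartition (m * m) lam).toMatIdx
              let T : Submodule ℂ (MvPolynomial (MatIdx m × MatIdx m) ℂ) :=
                MvPolynomial.homogeneousSubmodule (MatIdx m × MatIdx m) ℂ (m * δ) ⊓
                  ((MvPolynomial.vanishingIdeal ℂ
                      {p : MatIdx m × MatIdx m → ℂ | ∀ j : MatIdx m, (fun i => p (j, i)) ∈ U}) ^ (δ * (m - r))).restrictScalars ℂ ⊓
                  (⨅ (M : Matrix (MatIdx m) (MatIdx m) ℂ)
                    (_ : linSubst (MatIdx m) ℂ M (detFormLex ℂ m) = detFormLex ℂ m),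
                    LinearMap.ker ((MvPolynomial.aeval (R := ℂ) fun p : MatIdx m × MatIdx m =>
                        ∑ l : MatIdx m, M l p.2 • MvPolynomial.X (p.1, l)).toLinearMap -
                      LinearMap.id (R := ℂ) (M := MvPolynomial (MatIdx m × MatIdx m) ℂ))) ⊓
                  (⨅ (g : Matrix.GeneralLinearGroup (MatIdx m) ℂ) (_ : IsUpperTriangular g),
                    LinearMap.ker ((MvPolynomial.aeval (R := ℂ) fun p : MatIdx m × MatIdx m =>
                        ∑ l : MatIdx m, ((g⁻¹ : Matrix.GeneralLinearGroup (MatIdx m) ℂ) :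
                          Matrix (MatIdx m) (MatIdx m) ℂ) p.1 l • MvPolynomial.X (l, p.2)).toLinearMap -
                      weightChar χ g • LinearMap.id (R := ℂ) (M := MvPolynomial (MatIdx m × MatIdx m) ℂ)))
              orbitMultiplicity ℂ (paddedPerFormLex ℂ n m) m χ ≤ Module.finrank ℂ ↥T) := by
  constructor
  · rintro ⟨c₀, n₀, h⟩
    refine ⟨c₀ + 1, max n₀ 1, Nat.succ_pos _, fun n hn m _ hm _ => ?_⟩
    have hn₀ : n₀ ≤ n := le_of_max_le_left hn
    have hn1 : 1 ≤ n := le_of_max_le_right hn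
    have hm' : n ^ c₀ ≤ m := le_trans (Nat.pow_le_pow_right hn1 (Nat.le_succ c₀)) hm
    exact h n hn₀ m hm'
  · rintro ⟨c₀, n₀, hc₀, h⟩
    refine ⟨c₀, n₀, fun n hn m _ hm => ?_⟩
    have hc₀' : c₀ ≠ 0 := by omega
    have hnm : n ≤ m := (Nat.le_self_pow hc₀' n).trans hm
    set n₁ := Nat.findGreatest (fun k => k ^ c₀ ≤ m) m with hn₁
    have hn₁n : n ≤ n₁ := Nat.le_findGreatest hnm hm
    have hn₁m : n₁ ≤ m := Nat.findGreatest_le m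
    have hP₁ : n₁ ^ c₀ ≤ m := Nat.findGreatest_spec (P := fun k => k ^ c₀ ≤ m) hnm hm
    have hshallow : m < (n₁ + 1) ^ c₀ := by
      rcases hn₁m.eq_or_lt with heq | hlt
      · rw [heq]
        exact Nat.lt_of_lt_of_le (Nat.lt_succ_self m) (Nat.le_self_pow hc₀' (m + 1))
      · exact lt_of_not_ge (Nat.findGreatest_is_greatest (P := fun k => k ^ c₀ ≤ m)
          (Nat.lt_succ_self n₁) hlt)
    have h₁ := h n₁ (hn.trans hn₁n) m hP₁ hshallow
    exact noFlipBody_anti_inner hn₁n hn₁m h₁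

end

end Summit.ValiantsHypothesis.ValiantsHypothesis.Theorems.ValuativeFlip
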